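import Summits.AtomisticToContinuum.BoseEinsteinCondensation.Theorems.BECGroundStateSOSPeriodicIRBoundReduction
import Summits.AtomisticToContinuum.BoseEinsteinCondensation.Theorems.BECGroundStateSOSPeriodicIRBoundZeroMomentumGapIntegrable
import HarnessLib

/-!
# Route `BECGroundStateSOS`, crux `PeriodicIRBound` (stmt-AtomisticToContinuum-3972),
# line `linear-ph-floor-wagner` — the standing reduction after skeleton v12, as importable theorems

Sequel of `…PeriodicIRBoundReduction.lean` (seat -1, p96154: crux ⟸ stmt-9091 ∧ stmt-9094 ∧ stmt-11845 ∧ 6b)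
and `…PeriodicIRBoundReductionBounded.lean` (p97025: bounded potentials ⟸ stmt-9091 ∧ stmt-9094) after seat
c2 closed the zero-momentum gap for every INTEGRABLE repulsive finite-range pair potential
(`…PeriodicIRBoundZeroMomentumGapIntegrable.lean`, p115991: `zeroMomentumGapFor_of_integrable`,
`zeroMomentumGround_holds` = the pooled sibling item stmt-AtomisticToContinuum-11845 in full). The skeleton
`Cruxes/PeriodicIRBound/Lines/linear_ph_floor_wagner.lean` (v12) therefore has exactly three `sorry`s, and this
file states the same book-keeping as named tree theorems, so that the reduction can be cited and imported:

* `irBoundFor_of_linearFloor_of_integrable` — per potential: for an integrable admissible `v`, the crux's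
  infrared bound `IRBoundFor v` follows from the linear particle–hole floor `C⁺(v)` ALONE (needed only when
  `∫v ≠ 0`; the a.e.-free case is the free gas);
* `integrableClass_of_linearParticleHoleFloor` / `periodicIRBound_of_linearParticleHoleFloor` — the integrable
  class from the global `C⁺` (`LinearParticleHoleFloor`), and the whole crux BY NAME from `C⁺` and stub 6b
  (`HardCoreWagnerFeynmanBound`, the dressed per-mode moment bound for non-integrable `v`);
* `integrableClass_of_pooled` / `stub_reductionIntegrable` — the integrable class (crux form / γ-form) from the
  two pooled sibling items stmt-9091 `LandauSectorBound` and stmt-9094 `EnergyConvexityWindow` alone;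
* `periodicIRBound_of_open_inputs_v12` — the crux BY NAME from its three open inputs stmt-9091, stmt-9094, 6b.

All proofs are compositions of landed theorems (pure logic).
-/

noncomputable section

open scoped BigOperators ENNReal
open Filter MeasureTheory

namespace Summit.AtomisticToContinuum.BoseEinsteinCondensation.Cruxes.PeriodicIRBound.LinearPhFloorWagner

open Literature.MathematicalPhysics.QuantumManyBody.BoseGas
open Summit.AtomisticToContinuum.BoseEinsteinCondensation.Theses.BECGroundStateSOS (PeriodicIRBound)
open Summit.AtomisticToContinuum.BoseEinsteinCondensation.Theses.BECSectorPoincareTwoScale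
  (LandauSectorBound EnergyConvexityWindow)
open Summit.AtomisticToContinuum.BoseEinsteinCondensation.Theorems.PeriodicIRBound.Negative
  (IRBoundFor irBoundFor_iff_ground periodicIRBound_iff_split)

/-! ## Per-potential: integrable `v` needs only `C⁺(v)` -/

/-- **Integrable potentials, per `v`: the infrared bound from `C⁺(v)` alone.** For an integrable admissible
`v` the fixed-`(N,L)` zero-momentum gap is a theorem (`zeroMomentumGapFor_of_integrable`, seat c2's in-tree
Perron–Frobenius chain), so the two-sided Wagner–Feynman chain (`irBoundFor_of_linearFloor_of_gap`: landed
stubs 5b, 5c) needs only the linear particle–hole floor (when `∫v ≠ 0`). [folklore] -/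
theorem irBoundFor_of_linearFloor_of_integrable (v : ℝ → ℝ≥0∞) (hv : IsRepulsiveFiniteRange v)
    (hint : (∫⁻ x : Space, v ‖x‖) ≠ ⊤) (hfloor : (∫⁻ x : Space, v ‖x‖) ≠ 0 → LinearFloorFor v) :
    IRBoundFor v :=
  irBoundFor_of_linearFloor_of_gap v hv hint hfloor (zeroMomentumGapFor_of_integrable hv hint)

/-! ## From the global linear particle–hole floor `C⁺` -/

/-- **The integrable class from `C⁺`.** `LinearParticleHoleFloor` gives `IRBoundFor v` for every integrable
admissible `v` — no pooled item and no own stub of the line is involved any more. [folklore] -/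
theorem integrableClass_of_linearParticleHoleFloor (hF : LinearParticleHoleFloor) :
    ∀ v : ℝ → ℝ≥0∞, IsRepulsiveFiniteRange v → (∫⁻ x : Space, v ‖x‖) ≠ ⊤ → IRBoundFor v :=
  fun v hv hint => irBoundFor_of_linearFloor_of_integrable v hv hint (hF v hv)

/-- **The crux BY NAME from `C⁺` and stub 6b.** `LinearParticleHoleFloor` (the line's transfer target) and
`HardCoreWagnerFeynmanBound` (the dressed moment bound for non-integrable `v`) imply `PeriodicIRBound`
(split on `∫v = ⊤`: landed stub 6 on the non-integrable half). [folklore] -/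
theorem periodicIRBound_of_linearParticleHoleFloor (hF : LinearParticleHoleFloor)
    (h₈ : HardCoreWagnerFeynmanBound) : PeriodicIRBound :=
  periodicIRBound_iff_split.2
    ⟨integrableClass_of_linearParticleHoleFloor hF, fun v hv htop =>
      irBoundFor_of_linearFloor_of_hardCoreWF v hv htop (h₈ v hv htop)
        (hF v hv (ne_of_eq_of_ne htop ENNReal.top_ne_zero))⟩

/-! ## From the pooled sibling items stmt-9091 and stmt-9094 -/

/-- **The INTEGRABLE class of the crux from stmt-9091 and stmt-9094 alone** (crux form): every integrable
repulsive finite-range `v` — bounded or not — satisfies `IRBoundFor v` once `LandauSectorBound` and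
`EnergyConvexityWindow` hold (stmt-11845 being the landed `zeroMomentumGround_holds`). [folklore] -/
theorem integrableClass_of_pooled (h₁ : LandauSectorBound) (h₂ : EnergyConvexityWindow) :
    ∀ v : ℝ → ℝ≥0∞, IsRepulsiveFiniteRange v → (∫⁻ x : Space, v ‖x‖) ≠ ⊤ → IRBoundFor v :=
  integrableHalf_of_pooled h₁ h₂ zeroMomentumGround_holds

/-- **By-product sub-goal `stub_reductionIntegrable`: the crux for every INTEGRABLE admissible potential, in
γ-form, from the pooled items stmt-9091 and stmt-9094 alone** (the integrable twin of `stub_reductionBounded`).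
[folklore] -/
theorem stub_reductionIntegrable : LandauSectorBound → EnergyConvexityWindow →
    ∀ v : ℝ → ℝ≥0∞, IsRepulsiveFiniteRange v → (∫⁻ x : Space, v ‖x‖) ≠ ⊤ → GroundIRBoundFor v :=
  fun h₁ h₂ v hv hint => (groundIRBoundFor_iff v).2 (integrableClass_of_pooled h₁ h₂ v hv hint)

/-- **The crux BY NAME from its three open inputs after skeleton v12**: the pooled sibling items stmt-9091
`LandauSectorBound`, stmt-9094 `EnergyConvexityWindow` and the own stub 6b `HardCoreWagnerFeynmanBound` —
every other stub of the line, including stmt-11845, being a landed theorem. [folklore] -/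
theorem periodicIRBound_of_open_inputs_v12 (h₁ : LandauSectorBound) (h₂ : EnergyConvexityWindow)
    (h₈ : HardCoreWagnerFeynmanBound) : PeriodicIRBound :=
  stub_reduction h₁ h₂ zeroMomentumGround_holds h₈

/-- Cross-check: the same three-input reduction through `C⁺` (`linearParticleHoleFloor_of_pooled`) and
`periodicIRBound_of_linearParticleHoleFloor`. [folklore] -/
theorem periodicIRBound_of_open_inputs_v12' (h₁ : LandauSectorBound) (h₂ : EnergyConvexityWindow)
    (h₈ : HardCoreWagnerFeynmanBound) : PeriodicIRBound :=
  periodicIRBound_of_linearParticleHoleFloor (linearParticleHoleFloor_of_pooled h₁ h₂) h₈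

end Summit.AtomisticToContinuum.BoseEinsteinCondensation.Cruxes.PeriodicIRBound.LinearPhFloorWagner

end
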